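import Summits.KontsevichZagierPeriods.KontsevichZagierPeriods.Theorems.KzOnePeriodsBakerClasses

/-!
# KontsevichZagierPeriods — corpus instance G0-18 in the kernel: Dedekind's cubic field ("no relation", certified)

Cell pub-kz1p (KZ 1-periods), seat b2b-kz1p-1, helper of the rung-1 item; continuation of
`KzOnePeriodsBakerClasses.lean` (Baker's theorem, HW Prop. 15.10, PROVED in the tree as
`qbarLinearIndependent_one_twoPiI_log`).  Corpus case `G0-18-essential-discriminant-divisor-certified` of
`numerics/kz1p/tests/g0_corpus.json`: `K = ℚ(θ)`, `θ³ − θ² − 2θ − 8 = 0` — Dedekind's field, in which `2` divides the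
index of every monogenic order (`2` splits completely into three primes of degree `1`; `d_K = −503`; Cohen GTM 138,
Exercise 10 of Ch. 6, stated there for the equivalent polynomial `X³ + X² − 2X + 8 = −P(−X)`), so that the Kummer–Dedekind
route cannot read the primes above `2`; periods `log θ = ∫₁^θ dx/x` and `log 2`; query `log θ − log 2 = 0?`; expected
"no relation".  The corpus (v1.0) CERTIFIES the multiplicative independence of `θ` and `2` through a Round-2 maximal order
and the factorisation `2ℤ_K = 𝔭₁𝔭₂𝔭₃` (`v(θ) = (1,0,2)`, `v(2) = (1,1,1)`), with Baker entering as the cited hypothesis.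
Here the verdict is a KERNEL THEOREM, by a third, elementary route that needs no prime decomposition:

* `irreducible_dedekindCubic` — the cubic has no root modulo `3`, so it is irreducible over `ℤ` (monic, degree `3`) and
  over `ℚ` (Gauss); hence `1, θ, θ²` are `ℚ`-linearly independent (`dedekindCubic_quadratic_relation`, via `minpoly`);
* `dedekindCubic_pow_repr` — for `n ≥ 2`, `θⁿ = p + qθ + rθ²` with `p, q` even and `r` ODD (`θ³ = θ² + 2θ + 8`), so no
  `θⁿ` (`n ≥ 1`) is an integer power of `2` (`dedekindCubic_pow_ne_two_zpow`) and `θ^a 2^b = 1 ⇒ a = b = 0`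
  (`eq_zero_of_dedekindTheta_zpow_mul_two_zpow_eq_one`);
* `qbarLinearIndependent_one_twoPiI_log_dedekindTheta_log_two` — for the (unique) real root `θ`, `1, 2πi, log θ, log 2` are
  `ℚ̄`-linearly independent; in particular `log θ ≠ log 2` and no `ℚ̄`-relation at all holds.

[cite: HuberWustholz2022, Prop 15.10 p.150] [cite: Baker1975, Thm 2.1] [cite: Cohen1993, Exercise 6.10]
-/

namespace Summit.KontsevichZagierPeriods.KzOnePeriods

open Literature.NumberTheory.Transcendental
open Complex

section DedekindField

open Polynomial

/-- Dedekind's cubic `X³ − X² − 2X − 8` is irreducible over `ℚ`: it has no root modulo `3`, so (being monic) it is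
irreducible over `ℤ`, hence over `ℚ` by Gauss's lemma. [cite: Cohen1993, Exercise 6.10] [folklore] -/
theorem irreducible_dedekindCubic : Irreducible (X ^ 3 - X ^ 2 - 2 * X - 8 : ℚ[X]) := by
  have hmon : (X ^ 3 - X ^ 2 - 2 * X - 8 : ℤ[X]).Monic := by monicity!
  have h3 : Irreducible ((X ^ 3 - X ^ 2 - 2 * X - 8 : ℤ[X]).map (Int.castRingHom (ZMod 3))) := by
    have hmap : (X ^ 3 - X ^ 2 - 2 * X - 8 : ℤ[X]).map (Int.castRingHom (ZMod 3))
        = X ^ 3 - X ^ 2 - 2 * X - 8 := by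
      simp [Polynomial.map_sub, Polynomial.map_pow, Polynomial.map_mul]
    rw [hmap]
    refine irreducible_of_degree_le_three_of_not_isRoot ?_ ?_
    · have hdeg : (X ^ 3 - X ^ 2 - 2 * X - 8 : (ZMod 3)[X]).natDegree = 3 := by compute_degree!
      rw [hdeg]; decide
    · intro x hx
      simp [IsRoot] at hx
      revert x hx
      decide
  have hZ : Irreducible (X ^ 3 - X ^ 2 - 2 * X - 8 : ℤ[X]) :=
    Monic.irreducible_of_irreducible_map (Int.castRingHom (ZMod 3)) _ hmon h3
  have hQ := (IsPrimitive.Int.irreducible_iff_irreducible_map_cast hmon.isPrimitive).mp hZ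
  simpa [Polynomial.map_sub, Polynomial.map_pow, Polynomial.map_mul] using hQ

/-- For a root `θ` of Dedekind's cubic, `1, θ, θ²` satisfy no non-trivial `ℚ`-linear relation (the minimal polynomial
of `θ` over `ℚ` is the cubic, of degree `3 > 2`). [folklore] -/
theorem dedekindCubic_quadratic_relation {θ : ℝ} (hθ : θ ^ 3 - θ ^ 2 - 2 * θ - 8 = 0) {p q r : ℚ}
    (h : (p : ℝ) + q * θ + r * θ ^ 2 = 0) : p = 0 ∧ q = 0 ∧ r = 0 := by
  by_contra hne
  have gne : (C p + C q * X + C r * X ^ 2 : ℚ[X]) ≠ 0 := by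
    intro hg
    apply hne
    have c0 := congr_arg (fun g : ℚ[X] => g.coeff 0) hg
    have c1 := congr_arg (fun g : ℚ[X] => g.coeff 1) hg
    have c2 := congr_arg (fun g : ℚ[X] => g.coeff 2) hg
    simp [coeff_X, coeff_C, coeff_X_pow] at c0 c1 c2
    exact ⟨c0, c1, c2⟩
  have hmin : minpoly ℚ θ = X ^ 3 - X ^ 2 - 2 * X - 8 :=
    (minpoly.eq_of_irreducible_of_monic irreducible_dedekindCubic
      (by simp [map_ofNat]; linear_combination hθ) (by monicity!)).symm
  have hdeg3 : (minpoly ℚ θ).degree = 3 := by rw [hmin]; compute_degree!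
  have hle := minpoly.degree_le_of_ne_zero ℚ θ gne (by simp; linear_combination h)
  have h2 : (C p + C q * X + C r * X ^ 2 : ℚ[X]).degree ≤ 2 := by
    rw [show (C p + C q * X + C r * X ^ 2 : ℚ[X]) = C r * X ^ 2 + C q * X + C p by ring]
    exact degree_quadratic_le
  rw [hdeg3] at hle
  exact absurd (hle.trans h2) (by decide)

/-- Powers of a root `θ` of Dedekind's cubic in the basis `1, θ, θ²`: for `n ≥ 2`, `θⁿ = p + qθ + rθ²` with integers
`p, q` even and `r` odd (`θ³ = θ² + 2θ + 8`; `(p, q, r) ↦ (8r, p + 2r, q + r)` preserves these parities). [folklore] -/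
theorem dedekindCubic_pow_repr {θ : ℝ} (hθ : θ ^ 3 - θ ^ 2 - 2 * θ - 8 = 0) {n : ℕ} (hn : 2 ≤ n) :
    ∃ p q r : ℤ, θ ^ n = p + q * θ + r * θ ^ 2 ∧ Even p ∧ Even q ∧ Odd r := by
  induction n, hn using Nat.le_induction with
  | base => exact ⟨0, 0, 1, by simp, Even.zero, Even.zero, odd_one⟩
  | succ n hn ih =>
    obtain ⟨p, q, r, hrepr, hp, hq, hr⟩ := ih
    refine ⟨8 * r, p + 2 * r, q + r, ?_, ?_, ?_, ?_⟩
    · rw [pow_succ, hrepr]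
      push_cast
      linear_combination (r : ℝ) * hθ
    · exact ⟨4 * r, by ring⟩
    · exact hp.add ⟨r, by ring⟩
    · exact hq.add_odd hr

/-- No power `θⁿ` (`n ≥ 1`) of a root of Dedekind's cubic is an integer power of `2`
(`n = 1`: `θ` is irrational; `n ≥ 2`: the `θ²`-coordinate of `θⁿ` is odd). [folklore] -/
theorem dedekindCubic_pow_ne_two_zpow {θ : ℝ} (hθ : θ ^ 3 - θ ^ 2 - 2 * θ - 8 = 0) {n : ℕ}
    (hn : 1 ≤ n) (c : ℤ) : θ ^ n ≠ (2 : ℝ) ^ c := by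
  intro h
  rcases Nat.eq_or_lt_of_le hn with rfl | hn2
  · have hrel := dedekindCubic_quadratic_relation hθ (p := -(2 : ℚ) ^ c) (q := 1) (r := 0)
      (by push_cast; rw [pow_one] at h; linear_combination h)
    norm_num at hrel
  · obtain ⟨p, q, r, hrepr, -, -, hr⟩ := dedekindCubic_pow_repr hθ hn2
    have hrel := dedekindCubic_quadratic_relation hθ (p := (p : ℚ) - (2 : ℚ) ^ c) (q := q) (r := r)
      (by push_cast; linear_combination h - hrepr)
    obtain ⟨-, -, hr0⟩ := hrel
    have : r = 0 := by exact_mod_cast hr0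
    obtain ⟨k, hk⟩ := hr
    omega

/-- **`θ` and `2` are multiplicatively independent** for a root `θ` of Dedekind's cubic: `θ^a · 2^b = 1` with
`a, b ∈ ℤ` forces `a = b = 0` — the content of the corpus's certified lattice `{(a, b) : θ^a 2^b ∈ μ(K)} = 0`
(there: `v(θ) = (1, 0, 2)`, `v(2) = (1, 1, 1)` at the three primes above `2`), proved here without prime decomposition.
[cite: Cohen1993, Exercise 6.10] [folklore] -/
theorem eq_zero_of_dedekindTheta_zpow_mul_two_zpow_eq_one {θ : ℝ} (hθ : θ ^ 3 - θ ^ 2 - 2 * θ - 8 = 0)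
    {a b : ℤ} (h : θ ^ a * (2 : ℝ) ^ b = 1) : a = 0 ∧ b = 0 := by
  have hθpos : 0 < θ := by
    rcases lt_or_ge 0 θ with hpos | hle
    · exact hpos
    · nlinarith [mul_nonneg (neg_nonneg.mpr hle) (sq_nonneg θ), sq_nonneg (θ + 1)]
  have two : ∀ {b : ℤ}, (2 : ℝ) ^ b = 1 → b = 0 := fun h =>
    (zpow_eq_one_iff_right₀ (by norm_num) (by norm_num)).mp h
  obtain ⟨n, rfl | rfl⟩ := a.eq_nat_or_neg
  · rcases Nat.eq_zero_or_pos n with rfl | hn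
    · simp only [Nat.cast_zero, zpow_zero, one_mul] at h
      exact ⟨by simp, two h⟩
    · exfalso
      rw [zpow_natCast] at h
      have h' : θ ^ n = (2 : ℝ) ^ (-b) := by
        rw [zpow_neg]; exact eq_inv_of_mul_eq_one_left h
      exact dedekindCubic_pow_ne_two_zpow hθ hn (-b) h'
  · rcases Nat.eq_zero_or_pos n with rfl | hn
    · simp only [Nat.cast_zero, neg_zero, zpow_zero, one_mul] at h
      exact ⟨by simp, two h⟩
    · exfalso
      rw [zpow_neg, zpow_natCast, inv_mul_eq_one₀ (pow_ne_zero _ hθpos.ne')] at h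
      exact dedekindCubic_pow_ne_two_zpow hθ hn b h

/-- **G0-18 (Dedekind's field; "no relation", certified)**: for the real root `θ` of `X³ − X² − 2X − 8` (any real
root: there is exactly one), `1, 2πi, log θ, log 2` are `ℚ̄`-linearly independent; in particular `log θ − log 2 ≠ 0`
and no `ℚ̄`-relation at all holds.  Baker's theorem (PROVED in the tree) applied to the multiplicatively independent
algebraic numbers `θ, 2` (`eq_zero_of_dedekindTheta_zpow_mul_two_zpow_eq_one`).  KERNEL THEOREM (was: numerics + a
Round-2 / prime-splitting certificate of lattice completeness + Baker as the cited hypothesis, corpus case G0-18).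
[HW 2022, Prop 15.10 p.150] [cite: Baker1975, Thm 2.1] [cite: Cohen1993, Exercise 6.10] -/
theorem qbarLinearIndependent_one_twoPiI_log_dedekindTheta_log_two (θ : ℝ)
    (hθ : θ ^ 3 - θ ^ 2 - 2 * θ - 8 = 0) :
    QbarLinearIndependent ![(1 : ℂ), 2 * Real.pi * I, log (θ : ℂ), log 2] := by
  have hθpos : 0 < θ := by
    rcases lt_or_ge 0 θ with hpos | hle
    · exact hpos
    · nlinarith [mul_nonneg (neg_nonneg.mpr hle) (sq_nonneg θ), sq_nonneg (θ + 1)]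
  have halg : IsAlgebraic ℚ θ := by
    refine ⟨X ^ 3 - X ^ 2 - 2 * X - 8, irreducible_dedekindCubic.ne_zero, ?_⟩
    simp [map_ofNat]; linear_combination hθ
  have h := qbarLinearIndependent_one_twoPiI_log ![(θ : ℂ), 2]
    (fun i => by
      fin_cases i
      · simpa using halg.algebraMap (A := ℂ)
      · simpa using isAlgebraic_nat (R := ℚ) (A := ℂ) 2)
    (fun i => by
      have h0 : (θ : ℂ) ≠ 0 := by exact_mod_cast hθpos.ne'
      fin_cases i
      · simpa using h0
      · simp)
    (fun k hk => by
      rw [Fin.prod_univ_two] at hk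
      simp only [Matrix.cons_val_zero, Matrix.cons_val_one] at hk
      have hk' : θ ^ k 0 * (2 : ℝ) ^ k 1 = 1 := by
        apply Complex.ofReal_injective
        push_cast
        exact hk
      obtain ⟨h0, h1⟩ := eq_zero_of_dedekindTheta_zpow_mul_two_zpow_eq_one hθ hk'
      funext i; fin_cases i
      · exact h0
      · exact h1)
  convert h using 2
  funext i
  fin_cases i <;> simp

end DedekindField

end Summit.KontsevichZagierPeriods.KzOnePeriods
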